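import Mathlib.Probability.Distributions.Uniform
import Literature.Computability.Cryptography.HallgrenClassGroupGeneration
import HarnessLib

/-!
# Hallgren 2005 / class numbers under GRH — step N5b: uniformly random elements generate a finite
# group with probability `≥ 1 − #{subgroups}/2^T`

Topic `Literature/Computability/Cryptography`; proof companion of `HallgrenClassGroup.lean`
(named fact `Hallgren2005_classNumber_qsolvable_of_GRH`), specialising
`HallgrenClassGroupGeneration.lean` (`toOuterMeasure_closure_ne_top_le`: draws escaping every proper
subgroup with probability `≥ 1 − θ` fail to generate with probability `≤ #{subgroups} θ^T`) to
UNIFORM draws, where `θ = 1/2` (a proper subgroup has index `≥ 2`). Everything here is PROVED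
(theorems only; no definition, no named fact).

In the class-number algorithm this is the case of the characters `ψ_1, …, ψ_T` read off Kitaev's
eigenvalue measurement: they are uniform on the dual `Ĝ'` of the group `G'` generated by the chosen
forms (`kitaevCircuit_distributionChar`, `HallgrenClassGroupCharacterSums.lean`), and the
post-processing returns `|⟨ψ_1, …, ψ_T⟩|`, which is `|Ĝ'| = |G'|` exactly when they generate.

* `toOuterMeasure_uniform_subgroup_le_half` — `Pr_{uniform}[x ∈ H] ≤ 1/2` for a proper subgroup `H`;
* `toOuterMeasure_closure_range_ne_top_le` — `Pr[⟨w_1, …, w_T⟩ ≠ G] ≤ #{subgroups of G} / 2^T`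
  for `T` independent uniform `w_t`, and the explicit form with `#{subgroups} ≤ (|G|+1)^{⌊log₂|G|⌋}`.

## References

* K. K. H. Cheung, M. Mosca, *Decomposing finite abelian groups*, QIC 1 (2001), §3 [CheungMosca2001].
* I. M. Isaacs, *Finite Group Theory* (2008) (index of a proper subgroup) [folklore].
-/

noncomputable section

open scoped ENNReal

namespace Literature.Computability.Cryptography.Hallgren2005

open Literature.Probability.Distributions MeasureTheory

variable {G : Type*} [Group G] [Fintype G]

/-- **A proper subgroup has probability `≤ 1/2` under the uniform law** (its index is `≥ 2`,
Lagrange). [folklore] -/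
theorem toOuterMeasure_uniform_subgroup_le_half (H : Subgroup G) (hH : H ≠ ⊤) :
    (PMF.uniformOfFintype G).toOuterMeasure (H : Set G) ≤ 1 / 2 := by
  classical
  rw [PMF.toOuterMeasure_uniformOfFintype_apply]
  -- `2 |H| ≤ |G|`
  have hindex : 2 ≤ H.index := by
    have h1 := Subgroup.one_lt_index_of_ne_top hH
    omega
  have hmul : Nat.card H * H.index = Nat.card G := Subgroup.card_mul_index H
  have hcardH : Fintype.card (H : Set G) = Nat.card H := by
    rw [← Nat.card_eq_fintype_card]; rfl
  have h2 : 2 * Fintype.card (H : Set G) ≤ Fintype.card G := by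
    rw [hcardH, ← Nat.card_eq_fintype_card, ← hmul, mul_comm]
    exact Nat.mul_le_mul_left _ hindex
  have hG0 : (Fintype.card G : ℝ≥0∞) ≠ 0 := by exact_mod_cast Fintype.card_ne_zero
  have hGtop : (Fintype.card G : ℝ≥0∞) ≠ ⊤ := ENNReal.natCast_ne_top _
  rw [ENNReal.div_le_iff hG0 hGtop]
  have : ((Fintype.card (H : Set G) : ℕ) : ℝ≥0∞) * 2 ≤ (Fintype.card G : ℝ≥0∞) := by
    exact_mod_cast (by rw [mul_comm]; exact h2 : Fintype.card (H : Set G) * 2 ≤ Fintype.card G)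
  calc ((Fintype.card (H : Set G) : ℕ) : ℝ≥0∞) = ((Fintype.card (H : Set G) : ℕ) : ℝ≥0∞) * 2 * (1 / 2) := by
        rw [mul_assoc, ENNReal.mul_div_cancel (by norm_num) (by norm_num), mul_one]
    _ ≤ (Fintype.card G : ℝ≥0∞) * (1 / 2) := by gcongr
    _ = 1 / 2 * (Fintype.card G : ℝ≥0∞) := mul_comm _ _

/-- **Uniform draws generate**: for `T` independent uniform elements `w_1, …, w_T` of a finite group
`G`, `Pr[⟨w_1, …, w_T⟩ ≠ G] ≤ #{subgroups of G} / 2^T` (`toOuterMeasure_closure_ne_top_le` with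
`θ = 1/2`, `toOuterMeasure_uniform_subgroup_le_half`). [cite: CheungMosca2001, §3 (random elements generate)] -/
theorem toOuterMeasure_closure_range_ne_top_le (T : ℕ) :
    (indepLaw T fun _ => PMF.uniformOfFintype G).toOuterMeasure
        {w : Fin T → G | Subgroup.closure (Set.range w) ≠ ⊤} ≤
      Nat.card (Subgroup G) * (1 / 2) ^ T := by
  have h := toOuterMeasure_closure_ne_top_le (PMF.uniformOfFintype G) (fun g : G => ({g} : Set G))
    (θ := 1 / 2) (fun H hH => ?_) T
  · have hset : {w : Fin T → G | Subgroup.closure (Set.range w) ≠ ⊤} =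
        {w : Fin T → G | Subgroup.closure (⋃ t, ({w t} : Set G)) ≠ ⊤} := by
      ext w
      simp only [Set.mem_setOf_eq, Set.iUnion_singleton_eq_range]
    rw [hset]
    exact h
  · have hset : {ω : G | ({ω} : Set G) ⊆ (H : Set G)} = (H : Set G) := by
      ext ω; simp
    rw [hset]
    exact toOuterMeasure_uniform_subgroup_le_half H hH

/-- The same with the explicit subgroup count `#{subgroups} ≤ (|G| + 1)^{⌊log₂ |G|⌋}`
(`card_subgroup_le`). [cite: CheungMosca2001, §3 (random elements generate)] -/
theorem toOuterMeasure_closure_range_ne_top_le' (T : ℕ) :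
    (indepLaw T fun _ => PMF.uniformOfFintype G).toOuterMeasure
        {w : Fin T → G | Subgroup.closure (Set.range w) ≠ ⊤} ≤
      ((Nat.card G + 1) ^ Nat.log 2 (Nat.card G) : ℕ) * (1 / 2) ^ T := by
  refine (toOuterMeasure_closure_range_ne_top_le T).trans ?_
  gcongr
  exact_mod_cast card_subgroup_le

end Literature.Computability.Cryptography.Hallgren2005

end
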